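import Summits.Ventures.PercRepro.SixThreeTwoLines

/-!
# PercRepro — the profile of a two-line plane (`prof_of_twoLines`, `card_eq_of_twoLines`) (p2, gen 6)

Continuation of `SixThreeTwoLines.lean` (split for the 400-line file limit; proofs unchanged).
-/

namespace PercRepro

namespace SixThree

open Finset ThmH

variable {α : Type*} [DecidableEq α] {M : Matroid α} [M.Finite]

/-! ### The profile of a two-line plane -/

/-- On a two-line plane every line with `≥ 3` points of `G` is `L₁` or `L₂`. -/
theorem bigLines_subset_twoLines (hs : Simple M) {G L₁ L₂ : Finset α} (h12 : TwoLines M G L₁ L₂) :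
    bigLines M G ⊆ {L₁, L₂} := by
  intro L hL
  unfold bigLines at hL
  rw [Finset.mem_filter] at hL
  obtain ⟨hL, h3⟩ := hL
  -- three points of `L ∩ G` in `L₁ ∪ L₂`: two on the same `Lᵢ`
  have hsplit := Finset.card_filter_add_card_filter_not (s := L ∩ G) (p := fun y => y ∈ L₁)
  rw [Finset.mem_insert, Finset.mem_singleton]
  by_cases h2 : 2 ≤ ((L ∩ G).filter (fun y => y ∈ L₁)).card
  · left
    obtain ⟨u, hu, v, hv, huv⟩ := Finset.one_lt_card.1 h2
    rw [Finset.mem_filter, Finset.mem_inter] at hu hv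
    exact lines_eq_of_two_mem hs (Finset.mem_filter.1 hL).1 (Finset.mem_filter.1 h12.1).1 hu.1.1 hv.1.1 hu.2 hv.2 huv
  · right
    have h2' : 2 ≤ ((L ∩ G).filter (fun y => y ∉ L₁)).card := by omega
    obtain ⟨u, hu, v, hv, huv⟩ := Finset.one_lt_card.1 h2'
    rw [Finset.mem_filter, Finset.mem_inter] at hu hv
    have hu2 : u ∈ L₂ := by
      have := h12.2.2.2 hu.1.2
      rw [Finset.mem_union] at this
      rcases this with h | h
      · exact absurd h hu.2
      · exact h
    have hv2 : v ∈ L₂ := by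
      have := h12.2.2.2 hv.1.2
      rw [Finset.mem_union] at this
      rcases this with h | h
      · exact absurd h hv.2
      · exact h
    exact lines_eq_of_two_mem hs (Finset.mem_filter.1 hL).1 (Finset.mem_filter.1 h12.2.1).1 hu.1.1 hv.1.1 hu2 hv2 huv

/-- `g = m₁ + m₂ − |L₁ ∩ L₂ ∩ G|` on a two-line plane. -/
theorem card_eq_of_twoLines {G L₁ L₂ : Finset α} (h12 : TwoLines M G L₁ L₂) :
    G.card + (L₁ ∩ L₂ ∩ G).card = (L₁ ∩ G).card + (L₂ ∩ G).card := by
  have hcov : G = (L₁ ∩ G) ∪ (L₂ ∩ G) := by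
    ext y
    rw [Finset.mem_union, Finset.mem_inter, Finset.mem_inter]
    constructor
    · intro hy
      have := h12.2.2.2 hy
      rw [Finset.mem_union] at this
      rcases this with h | h
      · exact Or.inl ⟨h, hy⟩
      · exact Or.inr ⟨h, hy⟩
    · rintro (⟨-, hy⟩ | ⟨-, hy⟩) <;> exact hy
  have h := Finset.card_union_add_card_inter (L₁ ∩ G) (L₂ ∩ G)
  have hinter : (L₁ ∩ G) ∩ (L₂ ∩ G) = L₁ ∩ L₂ ∩ G := by
    ext y; simp only [Finset.mem_inter]; tauto
  rw [hinter, ← hcov] at h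
  exact h

/-- **The profile of a two-line plane** (`|L₁ ∩ G| ≥ 3`): `{m₁, m₂}` if `m₂ ≥ 3`, `{m₁}` if `m₂ = 2`. -/
theorem prof_of_twoLines (hs : Simple M) {G L₁ L₂ : Finset α} (h12 : TwoLines M G L₁ L₂)
    (h3 : 3 ≤ (L₁ ∩ G).card) :
    (3 ≤ (L₂ ∩ G).card ∧ prof M G = {(L₁ ∩ G).card, (L₂ ∩ G).card}) ∨
    ((L₂ ∩ G).card = 2 ∧ prof M G = {(L₁ ∩ G).card}) := by
  classical
  have hsub := bigLines_subset_twoLines hs h12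
  have hL₁big : L₁ ∈ bigLines M G := by
    unfold bigLines; rw [Finset.mem_filter]; exact ⟨h12.1, h3⟩
  have h2 : 2 ≤ (L₂ ∩ G).card := (Finset.mem_filter.1 h12.2.1).2
  by_cases h3' : 3 ≤ (L₂ ∩ G).card
  · left
    refine ⟨h3', ?_⟩
    have hbig : bigLines M G = {L₁, L₂} := by
      apply Finset.Subset.antisymm hsub
      intro L hL
      rw [Finset.mem_insert, Finset.mem_singleton] at hL
      rcases hL with rfl | rfl
      · exact hL₁big
      · unfold bigLines; rw [Finset.mem_filter]; exact ⟨h12.2.1, h3'⟩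
    rw [prof_eq, hbig]
    simp [Finset.insert_val, h12.2.2.1]
  · right
    refine ⟨by omega, ?_⟩
    have hbig : bigLines M G = {L₁} := by
      apply Finset.Subset.antisymm
      · intro L hL
        have := hsub hL
        rw [Finset.mem_insert, Finset.mem_singleton] at this
        rw [Finset.mem_singleton]
        rcases this with rfl | rfl
        · rfl
        · exfalso
          unfold bigLines at hL
          rw [Finset.mem_filter] at hL
          exact h3' hL.2
      · intro L hL
        rw [Finset.mem_singleton] at hL
        rw [hL]; exact hL₁big
    rw [prof_eq, hbig]
    simp

end SixThree

end PercRepro
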